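import Summits.CriticalPhenomena.CardyFormulaZ2.Theorems.CardySelfRefinementLagHandOffColumnEscape
import Summits.CriticalPhenomena.CardyFormulaZ2.Theorems.CardySelfRefinementLagHandOffRotationData
import Literature.Probability.Percolation.SeedLemma
import HarnessLib

/-!
# The lattice dictionary at a ROW cross-cut approached from BELOW (quarter turn of the column
dictionary)
(groundwork for stub `stub_tournamentTransfer`, line `hitting-tournament`, crux `LagHandOff`,
stmt-CriticalPhenomena-10268; registered sub-goal stub `stub_tournamentTransfer_belowDictionary`)

The exact lattice dictionary "first arrival of the bond-`ℤ²` medial exploration at a straight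
cross-cut = extreme cross-cut site of the open cluster of the arc `A` grown on the near side"
(Holden–Sun, arXiv:1905.13207, Prop. 6.25 (1), transplanted to G02's medial exploration of
bond percolation on `δℤ²`, Smirnov 2001 §2) is in the tree for COLUMNS approached from the WEST
(`stub_tournamentTransfer_columnDictionary`, escape hypotheses discharged for Jordan carriers by
`stub_tournamentTransfer_escape`).  This file turns it by a quarter turn `z ↦ i z`:

* `medialExploration_rot` — the medial exploration of the turned data (`…RotationData`) in the
  turned configuration is the turned exploration (from `explorationList_rot` of
  `…RotationCorners` and the characterisation of the exploration as the cut orbit);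
* `sym2Equiv_rot_image_setOf`, `relabel_inter_mem_openConnIn_iff` — transport of half-planes
  of edges and of restricted open connections along `rotCell` (on top of the tree's
  `GM.relabel_mem_openConnIn_iff`);
* `columnDictionary_rot` — ONE generic transport step: the column-from-the-west dictionary for
  data `E` gives the row-from-below dictionary for the turned data `E'`
  (`E'.Ω = i·E.Ω`, same mesh, turned arcs);
* `exists_rot_data`, `image_mul_I_four` — turned Dobrushin data on the turned Dobrushin domain
  (`MarkedDomain.map (similarity i _ 0)`), and four quarter turns are the identity; so data on a
  Dobrushin domain are the quarter turn of admissible data on a Dobrushin domain (turn thrice);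
* `stub_tournamentTransfer_belowDictionary` — the registered sub-goal.

References: S. Smirnov, C. R. Acad. Sci. Paris 333 (2001), §2; G. Grimmett, *Percolation*
(1999), §1.6 (lattice symmetries), §11.2; N. Holden, X. Sun, arXiv:1905.13207, Prop. 6.25.
-/

noncomputable section

open Set
open Literature.Probability.Percolation Literature.Probability.LatticeModels
open Literature.Probability.RandomPlanarGeometry

namespace Summit.CriticalPhenomena.CardyFormulaZ2.Cruxes.LagHandOff.HittingTournament

/-! ### Transport of restricted open connections and of half-planes of edges -/

/-- A symmetric condition on the two endpoints, quantified over all presentations of `s(x, y)`,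
is the condition at `(x, y)`. [folklore] -/
theorem forall_mk_eq_iff {P : Site 2 → Site 2 → Prop} (hP : ∀ x y, P x y → P y x) (x y : Site 2) :
    (∀ a b : Site 2, s(x, y) = s(a, b) → P a b) ↔ P x y := by
  constructor
  · exact fun h => h x y rfl
  · intro h a b hab
    rcases Sym2.eq_iff.1 hab with ⟨rfl, rfl⟩ | ⟨rfl, rfl⟩
    · exact h
    · exact hP _ _ h

/-- The quarter turn carries the set of edges cut out by a symmetric endpoint condition `P` onto
the set cut out by `Q`, when `Q (rotCell x) (rotCell y) ↔ P x y`. [folklore] -/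
theorem sym2Equiv_rot_image_setOf {P Q : Site 2 → Site 2 → Prop}
    (hPQ : ∀ x y, Q (rotCell x) (rotCell y) ↔ P x y) (hP : ∀ x y, P x y → P y x)
    (hQ : ∀ x y, Q x y → Q y x) :
    sym2Equiv rotCell '' {e | ∀ x y : Site 2, e = s(x, y) → P x y} =
      {e | ∀ x y : Site 2, e = s(x, y) → Q x y} := by
  ext e'
  induction e' using Sym2.ind with
  | h x' y' =>
    obtain ⟨x, rfl⟩ := rotCell.surjective x'
    obtain ⟨y, rfl⟩ := rotCell.surjective y'
    rw [← sym2Equiv_mk, (sym2Equiv rotCell).injective.mem_set_image, Set.mem_setOf_eq,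
      Set.mem_setOf_eq, sym2Equiv_mk, forall_mk_eq_iff hP, forall_mk_eq_iff hQ, hPQ]

/-- Restricted open connections of a turned configuration cut down to a turned set of edges.
[folklore] -/
theorem relabel_inter_mem_openConnIn_iff (β A A' : BondConfig (Site 2))
    (hA : sym2Equiv rotCell '' A = A') (S : Set (Site 2)) (a b : Site 2) :
    BondConfig.relabel (sym2Equiv rotCell) β ∩ A' ∈ openConnIn S (rotCell a) (rotCell b) ↔
      β ∩ A ∈ openConnIn (rotCell ⁻¹' S) a b := by
  rw [← hA, BondConfig.relabel_apply, ← Set.image_inter (sym2Equiv rotCell).injective,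
    ← BondConfig.relabel_apply, GM.relabel_mem_openConnIn_iff]

/-! ### The exploration of the turned data -/

section Data

open Summit.CriticalPhenomena.CardyFormulaZ2.Cruxes.LagHandOff.CrosscutDictionary
  (exists_medialExploration_eq_explorationList)

variable {E E' : DiscreteDobrushin}
  (hΩ : E'.Ω = (fun z => Complex.I * z) '' E.Ω) (hδ : E'.δ = E.δ)
  (hA : E'.arcA = (fun z => Complex.I * z) '' E.arcA)
  (hB : E'.arcB = (fun z => Complex.I * z) '' E.arcB)

include hΩ hδ hA hB

/-- **Quarter-turn covariance of the medial exploration.** For admissible data `E` (with a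
start corner) and the turned data `E'`, the medial exploration of the turned configuration in
`E'` is the turned medial exploration: both are cut orbits (`…ExplorationPrefix`), the orbits
correspond (`explorationList_rot`) and so do the inner faces deciding the cut
(`isInnerFace_rot_iff`). [cite: Smirnov2001, §2] -/
theorem medialExploration_rot (hE : E.IsZdAdmissible) {c₀ : Site 2 × Fin 4}
    (hc₀ : E.IsStartCorner c₀) (ω : BondConfig (Site 2)) :
    medialExploration E' (BondConfig.relabel (sym2Equiv rotCell) ω) =
      (medialExploration E ω).map (sym2Equiv rotCell) := by
  obtain ⟨N, hN, hlt, heq⟩ := exists_medialExploration_eq_explorationList hE hc₀ ω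
  have hE' : E'.IsZdAdmissible := isZdAdmissible_rot hΩ hδ hA hB hE
  have hc₀' : E'.IsStartCorner (rotCell c₀.1, c₀.2 + 1) :=
    (isStartCorner_rot_iff hΩ hδ hA hB c₀).2 hc₀
  obtain ⟨N', hN', hlt', heq'⟩ := exists_medialExploration_eq_explorationList hE' hc₀'
    (BondConfig.relabel (sym2Equiv rotCell) ω)
  rw [bcBondConfig_rot hΩ hδ hA hB] at hN' hlt' heq'
  simp only [cFace_cornerOrbit_rot, isInnerFace_rot_iff hΩ hδ] at hN' hlt'
  obtain rfl : N = N' := by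
    by_contra hne
    rcases Nat.lt_or_gt_of_ne hne with h | h
    · exact hN (hlt' N h)
    · exact hN' (hlt N' h)
  rw [heq', heq, explorationList_rot]

/-- **The generic transport step: column-from-the-west dictionary for `E` ⟹ row-from-below
dictionary for the turned data `E'`.**  Every clause is transported along the lattice
automorphism `rotCell` (sites), `sym2Equiv rotCell` (edges) and `BondConfig.relabel` thereof
(configurations): `x ↦ rotCell x` exchanges `x 0` with `(rotCell x) 1`, the half-planes
`{x 0 + y 0 < 2k}` with `{x 1 + y 1 < 2k}`, the unit vectors `cornerUnit k` with
`cornerUnit (k + 1)`, restricted open connections with restricted open connections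
(`GM.relabel_mem_openConnIn_iff`), the graph `Ω_δ` with the turned one (`adj_rot_iff`), and the
exploration with the turned exploration (`medialExploration_rot`). [cite: Smirnov2001, §2] -/
theorem columnDictionary_rot (hE : E.IsZdAdmissible)
    (hW : ∀ (c₀ : Site 2 × Fin 4) (ω : BondConfig (Site 2)) (k : ℤ), E.IsStartCorner c₀ →
      c₀.1 0 < k → (∃ e ∈ medialExploration E ω, ∀ x y : Site 2, e = s(x, y) → 2 * k ≤ x 0 + y 0) →
      ∃ (τ : ℕ) (v : Site 2), τ + 2 < (medialExploration E ω).length ∧ v 0 = k ∧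
        (medialExploration E ω)[τ + 2]? = some s(v, v + cornerUnit 3) ∧
        (∀ i < τ + 2, ∀ x y : Site 2, (medialExploration E ω)[i]? = some s(x, y) →
          x 0 + y 0 < 2 * k) ∧
        E.bcBondConfig ω ∩ {e | ∀ x y : Site 2, e = s(x, y) → x 0 + y 0 < 2 * k} ∈
          openConnIn {u : Site 2 | u 0 ≤ k} c₀.1 v ∧
        ∀ w : Site 2, w 0 = k → w 1 < v 1 →
          (∀ z : Site 2, z 0 = k → w 1 ≤ z 1 → z 1 < v 1 →
            (discreteDomainGraph E.Ω E.δ).Adj z (z + Pi.single 1 1)) →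
          ∀ S : Set (Site 2), E.bcBondConfig ω ∩
            {e | ∀ x y : Site 2, e = s(x, y) → x 0 + y 0 < 2 * k} ∉ openConnIn S c₀.1 w)
    (c₀ : Site 2 × Fin 4) (ω : BondConfig (Site 2)) (r : ℤ) (hc₀ : E'.IsStartCorner c₀)
    (hside : c₀.1 1 < r)
    (hfar : ∃ e ∈ medialExploration E' ω, ∀ x y : Site 2, e = s(x, y) → 2 * r ≤ x 1 + y 1) :
    ∃ (τ : ℕ) (v : Site 2), τ + 2 < (medialExploration E' ω).length ∧ v 1 = r ∧
      (medialExploration E' ω)[τ + 2]? = some s(v, v + cornerUnit 0) ∧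
      (∀ i < τ + 2, ∀ x y : Site 2, (medialExploration E' ω)[i]? = some s(x, y) →
        x 1 + y 1 < 2 * r) ∧
      E'.bcBondConfig ω ∩ {e | ∀ x y : Site 2, e = s(x, y) → x 1 + y 1 < 2 * r} ∈
        openConnIn {u : Site 2 | u 1 ≤ r} c₀.1 v ∧
      ∀ w : Site 2, w 1 = r → v 0 < w 0 →
        (∀ z : Site 2, z 1 = r → v 0 < z 0 → z 0 ≤ w 0 →
          (discreteDomainGraph E'.Ω E'.δ).Adj z (z + cornerUnit 2)) →
        ∀ S : Set (Site 2), E'.bcBondConfig ω ∩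
          {e | ∀ x y : Site 2, e = s(x, y) → x 1 + y 1 < 2 * r} ∉ openConnIn S c₀.1 w := by
  -- pull the start corner and the configuration back to `E`
  obtain ⟨a', d'⟩ := c₀
  obtain ⟨a, rfl⟩ := rotCell.surjective a'
  obtain ⟨d, rfl⟩ : ∃ d, d + 1 = d' := ⟨d' + 3, fin4_add_three_add_one d'⟩
  obtain ⟨ω₀, rfl⟩ := (BondConfig.relabel (sym2Equiv rotCell)).surjective ω
  have hc : E.IsStartCorner (a, d) := (isStartCorner_rot_iff hΩ hδ hA hB (a, d)).1 hc₀
  have hmE := medialExploration_rot hΩ hδ hA hB hE hc ω₀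
  have hside' : a 0 < r := by simpa using hside
  -- the set of edges strictly west of the column is turned onto that strictly below the row
  have hset : sym2Equiv rotCell '' {e | ∀ x y : Site 2, e = s(x, y) → x 0 + y 0 < 2 * r} =
      {e | ∀ x y : Site 2, e = s(x, y) → x 1 + y 1 < 2 * r} :=
    sym2Equiv_rot_image_setOf (fun x y => by simp) (fun x y h => by omega) (fun x y h => by omega)
  have hpre : rotCell ⁻¹' {u : Site 2 | u 1 ≤ r} = {u : Site 2 | u 0 ≤ r} := by
    ext u; simp
  rw [hmE] at hfar ⊢
  -- the far medial vertex, pulled back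
  have hfar₀ : ∃ e ∈ medialExploration E ω₀, ∀ x y : Site 2, e = s(x, y) → 2 * r ≤ x 0 + y 0 := by
    obtain ⟨e', he', hfar'⟩ := hfar
    obtain ⟨e, he, rfl⟩ := List.mem_map.1 he'
    refine ⟨e, he, fun x y hxy => ?_⟩
    have h := hfar' (rotCell x) (rotCell y) (by rw [hxy]; rfl)
    simpa using h
  obtain ⟨τ, v, hlen, hv, hhit, hbefore, hleft, hmin⟩ := hW (a, d) ω₀ r hc hside' hfar₀
  refine ⟨τ, rotCell v, ?_, ?_, ?_, ?_, ?_, ?_⟩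
  · rwa [List.length_map]
  · simpa using hv
  · rw [List.getElem?_map, hhit, Option.map_some, sym2Equiv_mk, rotCell_add, rotCell_cornerUnit]
    rfl
  · intro i hi x' y' h
    obtain ⟨x, rfl⟩ := rotCell.surjective x'
    obtain ⟨y, rfl⟩ := rotCell.surjective y'
    rw [List.getElem?_map, Option.map_eq_some_iff] at h
    obtain ⟨e, he, hexy⟩ := h
    have hexy' : e = s(x, y) := (sym2Equiv rotCell).injective (by rw [hexy]; rfl)
    have h := hbefore i hi x y (by rw [he, hexy'])
    simpa using h
  · show _ ∈ openConnIn _ (rotCell a) (rotCell v)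
    rw [bcBondConfig_rot hΩ hδ hA hB, relabel_inter_mem_openConnIn_iff _ _ _ hset, hpre]
    exact hleft
  · intro w' hw' hvw' hseg S
    obtain ⟨w, rfl⟩ := rotCell.surjective w'
    have hw : w 0 = r := by simpa using hw'
    have hvw : w 1 < v 1 := by
      simp only [rotCell_apply_zero] at hvw'
      omega
    have hseg₀ : ∀ z : Site 2, z 0 = r → w 1 ≤ z 1 → z 1 < v 1 →
        (discreteDomainGraph E.Ω E.δ).Adj z (z + Pi.single 1 1) := by
      intro z hz0 hz1 hz2
      have h := hseg (rotCell z) (by simpa using hz0)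
        (by simp only [rotCell_apply_zero]; omega) (by simp only [rotCell_apply_zero]; omega)
      rw [show rotCell z + cornerUnit 2 = rotCell (z + cornerUnit 1) by
        rw [rotCell_add, rotCell_cornerUnit]; rfl, adj_rot_iff hΩ hδ] at h
      exact h
    show _ ∉ openConnIn _ (rotCell a) (rotCell w)
    rw [bcBondConfig_rot hΩ hδ hA hB, relabel_inter_mem_openConnIn_iff _ _ _ hset]
    exact hmin w hw hvw hseg₀ _

end Data

/-! ### Turned data on turned Dobrushin domains -/

/-- **Turned Dobrushin data on the turned Dobrushin domain.** For admissible data `E` on the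
carrier of a Dobrushin domain `D`, the turned data (domain and arcs multiplied by `i`, same
mesh) are admissible data on the carrier of the turned Dobrushin domain
`D.map (similarity i _ 0)`. [cite: Smirnov2001, §2] -/
theorem exists_rot_data (D : DobrushinDomain) {E : DiscreteDobrushin} (hΩD : E.Ω = D.carrier)
    (hE : E.IsZdAdmissible) :
    ∃ (D' : DobrushinDomain) (E' : DiscreteDobrushin), E'.Ω = D'.carrier ∧ E'.IsZdAdmissible ∧
      E'.Ω = (fun z => Complex.I * z) '' E.Ω ∧ E'.δ = E.δ ∧
      E'.arcA = (fun z => Complex.I * z) '' E.arcA ∧ E'.arcB = (fun z => Complex.I * z) '' E.arcB := by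
  refine ⟨D.map (similarity Complex.I Complex.I_ne_zero 0),
    ⟨(fun z => Complex.I * z) '' E.Ω, E.δ, (fun z => Complex.I * z) '' E.arcA,
      (fun z => Complex.I * z) '' E.arcB⟩, ?_,
    isZdAdmissible_rot (E := E) rfl rfl rfl rfl hE, rfl, rfl, rfl, rfl⟩
  show (fun z => Complex.I * z) '' E.Ω = (D.map (similarity Complex.I Complex.I_ne_zero 0)).carrier
  rw [MarkedDomain.carrier_map, hΩD]
  refine congrArg (· '' D.carrier) (funext fun z => ?_)
  simp [similarity_apply]

/-- Four quarter turns are the identity: `i⁴ S = S`. [folklore] -/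
theorem image_mul_I_four (S : Set ℂ) :
    (fun z => Complex.I * z) '' ((fun z => Complex.I * z) '' ((fun z => Complex.I * z) ''
      ((fun z => Complex.I * z) '' S))) = S := by
  have h : ∀ z : ℂ, Complex.I * (Complex.I * (Complex.I * (Complex.I * z))) = z := fun z => by
    calc Complex.I * (Complex.I * (Complex.I * (Complex.I * z)))
        = (Complex.I * Complex.I) * (Complex.I * Complex.I) * z := by ring
      _ = z := by rw [Complex.I_mul_I]; ring
  simp only [Set.image_image, h, Set.image_id']

/-- **The column dictionary for data on a Dobrushin domain** (`stub_tournamentTransfer_escape` +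
`stub_tournamentTransfer_columnDictionary`), in the implication form transported by
`columnDictionary_rot`. [cite: Smirnov2001, §2] -/
theorem columnDictionary_of_carrier (D : DobrushinDomain) {E : DiscreteDobrushin}
    (hΩD : E.Ω = D.carrier) (hE : E.IsZdAdmissible) :
    ∀ (c₀ : Site 2 × Fin 4) (ω : BondConfig (Site 2)) (k : ℤ), E.IsStartCorner c₀ →
      c₀.1 0 < k → (∃ e ∈ medialExploration E ω, ∀ x y : Site 2, e = s(x, y) → 2 * k ≤ x 0 + y 0) →
      ∃ (τ : ℕ) (v : Site 2), τ + 2 < (medialExploration E ω).length ∧ v 0 = k ∧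
        (medialExploration E ω)[τ + 2]? = some s(v, v + cornerUnit 3) ∧
        (∀ i < τ + 2, ∀ x y : Site 2, (medialExploration E ω)[i]? = some s(x, y) →
          x 0 + y 0 < 2 * k) ∧
        E.bcBondConfig ω ∩ {e | ∀ x y : Site 2, e = s(x, y) → x 0 + y 0 < 2 * k} ∈
          openConnIn {u : Site 2 | u 0 ≤ k} c₀.1 v ∧
        ∀ w : Site 2, w 0 = k → w 1 < v 1 →
          (∀ z : Site 2, z 0 = k → w 1 ≤ z 1 → z 1 < v 1 →
            (discreteDomainGraph E.Ω E.δ).Adj z (z + Pi.single 1 1)) →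
          ∀ S : Set (Site 2), E.bcBondConfig ω ∩
            {e | ∀ x y : Site 2, e = s(x, y) → x 0 + y 0 < 2 * k} ∉ openConnIn S c₀.1 w := by
  intro c₀ ω k hc₀ hside hfar
  obtain ⟨uTop, ε, hε, htop⟩ := stub_tournamentTransfer_escape D E c₀ hΩD hE hc₀
  exact stub_tournamentTransfer_columnDictionary E c₀ ω k uTop ε hE hc₀ hside hfar hε htop

/-- **Three quarter turns of data on a Dobrushin domain**: admissible data `E` on the carrier of
a Dobrushin domain are the quarter turn of admissible data `E₃` on the carrier of a Dobrushin
domain (namely of the data turned thrice), and `E₃` is in turn the quarter turn of the data `E₂`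
turned twice, `E₂` that of the data `E₁` turned once, `E₁` that of `E`. [cite: Smirnov2001, §2] -/
theorem exists_rot_data_three (D : DobrushinDomain) {E : DiscreteDobrushin} (hΩD : E.Ω = D.carrier)
    (hE : E.IsZdAdmissible) :
    ∃ (D₁ D₂ D₃ : DobrushinDomain) (E₁ E₂ E₃ : DiscreteDobrushin),
      (E₁.Ω = D₁.carrier ∧ E₁.IsZdAdmissible) ∧ (E₂.Ω = D₂.carrier ∧ E₂.IsZdAdmissible) ∧
      (E₃.Ω = D₃.carrier ∧ E₃.IsZdAdmissible) ∧
      (E₁.Ω = (fun z => Complex.I * z) '' E.Ω ∧ E₁.δ = E.δ ∧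
        E₁.arcA = (fun z => Complex.I * z) '' E.arcA ∧ E₁.arcB = (fun z => Complex.I * z) '' E.arcB) ∧
      (E₂.Ω = (fun z => Complex.I * z) '' E₁.Ω ∧ E₂.δ = E₁.δ ∧
        E₂.arcA = (fun z => Complex.I * z) '' E₁.arcA ∧ E₂.arcB = (fun z => Complex.I * z) '' E₁.arcB) ∧
      (E₃.Ω = (fun z => Complex.I * z) '' E₂.Ω ∧ E₃.δ = E₂.δ ∧
        E₃.arcA = (fun z => Complex.I * z) '' E₂.arcA ∧ E₃.arcB = (fun z => Complex.I * z) '' E₂.arcB) ∧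
      (E.Ω = (fun z => Complex.I * z) '' E₃.Ω ∧ E.δ = E₃.δ ∧
        E.arcA = (fun z => Complex.I * z) '' E₃.arcA ∧ E.arcB = (fun z => Complex.I * z) '' E₃.arcB) := by
  obtain ⟨D₁, E₁, hΩ₁, hE₁, h1Ω, h1δ, h1A, h1B⟩ := exists_rot_data D hΩD hE
  obtain ⟨D₂, E₂, hΩ₂, hE₂, h2Ω, h2δ, h2A, h2B⟩ := exists_rot_data D₁ hΩ₁ hE₁
  obtain ⟨D₃, E₃, hΩ₃, hE₃, h3Ω, h3δ, h3A, h3B⟩ := exists_rot_data D₂ hΩ₂ hE₂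
  refine ⟨D₁, D₂, D₃, E₁, E₂, E₃, ⟨hΩ₁, hE₁⟩, ⟨hΩ₂, hE₂⟩, ⟨hΩ₃, hE₃⟩, ⟨h1Ω, h1δ, h1A, h1B⟩,
    ⟨h2Ω, h2δ, h2A, h2B⟩, ⟨h3Ω, h3δ, h3A, h3B⟩, ?_, ?_, ?_, ?_⟩
  · rw [h3Ω, h2Ω, h1Ω, image_mul_I_four]
  · rw [h3δ, h2δ, h1δ]
  · rw [h3A, h2A, h1A, image_mul_I_four]
  · rw [h3B, h2B, h1B, image_mul_I_four]

/-! ### The registered sub-goal -/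

/-- **Registered sub-goal stub `stub_tournamentTransfer_belowDictionary`: the lattice dictionary
at a ROW cross-cut `{im = r}` approached from BELOW, for admissible data on a Dobrushin domain.**
For a start corner strictly below the row (`c₀.1 1 < r`) and an exploration that does not stay in
`{im < r}`: the FIRST medial vertex of the exploration on the row is the horizontal edge
`{v, v + e₀}` east of a row site `v` (all earlier ones lie in `{im < r}`); `v` is joined to the
`A`-end `c₀.1` of `e_a` by open edges of `{im < r}`; and no row site strictly EAST of `v` on the
same row segment of `Ω_δ` is so joined — the arrival vertex is the extreme site of its row
cross-cut in the open cluster of `A` grown strictly below the cross-cut (Holden–Sun Prop. 6.25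
(1) for the bond-`ℤ²` medial exploration).  Proof: the data are the quarter turn of admissible
data on a Dobrushin domain (`exists_rot_data_three`), for which the column dictionary holds
(`columnDictionary_of_carrier`); transport it (`columnDictionary_rot`). [cite: Smirnov2001, §2] -/
theorem stub_tournamentTransfer_belowDictionary : ∀ (D : DobrushinDomain) (E : DiscreteDobrushin) (c₀ : Site 2 × Fin 4) (ω : BondConfig (Site 2)) (r : ℤ), E.Ω = D.carrier → E.IsZdAdmissible → E.IsStartCorner c₀ → c₀.1 1 < r → (∃ e ∈ medialExploration E ω, ∀ x y : Site 2, e = s(x, y) → 2 * r ≤ x 1 + y 1) → ∃ (τ : ℕ) (v : Site 2), τ + 2 < (medialExploration E ω).length ∧ v 1 = r ∧ (medialExploration E ω)[τ + 2]? = some s(v, v + cornerUnit 0) ∧ (∀ i < τ + 2, ∀ x y : Site 2, (medialExploration E ω)[i]? = some s(x, y) → x 1 + y 1 < 2 * r) ∧ E.bcBondConfig ω ∩ {e | ∀ x y : Site 2, e = s(x, y) → x 1 + y 1 < 2 * r} ∈ openConnIn {u : Site 2 | u 1 ≤ r} c₀.1 v ∧ ∀ w : Site 2, w 1 = r → v 0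 < w 0 → (∀ z : Site 2, z 1 = r → v 0 < z 0 → z 0 ≤ w 0 → (discreteDomainGraph E.Ω E.δ).Adj z (z + cornerUnit 2)) → ∀ S : Set (Site 2), E.bcBondConfig ω ∩ {e | ∀ x y : Site 2, e = s(x, y) → x 1 + y 1 < 2 * r} ∉ openConnIn S c₀.1 w := by
  intro D E c₀ ω r hΩD hE hc₀ hside hfar
  obtain ⟨-, -, D₃, -, -, E₃, -, -, ⟨hΩ₃, hE₃⟩, -, -, -, h4Ω, h4δ, h4A, h4B⟩ :=
    exists_rot_data_three D hΩD hE
  exact columnDictionary_rot h4Ω h4δ h4A h4B hE₃ (columnDictionary_of_carrier D₃ hΩ₃ hE₃)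
    c₀ ω r hc₀ hside hfar

end Summit.CriticalPhenomena.CardyFormulaZ2.Cruxes.LagHandOff.HittingTournament

end
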